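import Summits.QuantumAdvantage.QuantumAdvantage.Theorems.MobiusLadderLiouvilleOrthogonalTC0Defs
import HarnessLib

/-!
# Crux `MobiusLadder.LiouvilleOrthogonalTC0` (stmt-QuantumAdvantage-1393), line `Sketch`:
# the hypothesis `LocalPieceHardness` at degenerate and small scale exponents

Structural facts about the line's hypothesis `LocalPieceHardness δ₀ κ Λ₀ A`
(`Theorems/MobiusLadderLiouvilleOrthogonalTC0Defs.lean`), recorded by the continuation lead
(`prover-line-stmt-QuantumAdvantage-1393-c1-0`) because they force a reshape of the line's open stub:

* `not_localPieceHardness_zero` — at the degenerate exponent `A = 0` the hypothesis is FALSE for every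
  `δ₀ > 0`: Lean's `n / 0 = 0` and `n ^ (-0) = 1` collapse the side conditions to `y ≥ 1`, `θ = 1`,
  `#U ≥ 1`, the one-element piece `U(n; 1, 1; 1, 1) = {1}` qualifies, and the constant circuit `false`
  predicts `[λ(1) = -1] = false` without error.  Hence the originally registered stub
  `∃ δ₀ κ Λ₀, 0 < δ₀ ∧ 0 < κ ∧ 1 ≤ Λ₀ ∧ ∀ A, LocalPieceHardness δ₀ κ Λ₀ A` is refuted
  (`not_exists_localPieceHardness_all`) and the landed transfer `stub_transfer` (hypothesis `∀ A`) is
  vacuous; the repaired stub quantifies over `A ≥ 1`.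
* `localPieceHardness_anti` — for `1 ≤ A ≤ A'`, hardness at `A'` implies hardness at `A` (larger `A`
  only admits more pieces), so `∀ A ≥ 1` is the same as hardness at arbitrarily large `A`.
* `localPieceHardness_of_le` — for `1 ≤ A ≤ 2 + κ` the hypothesis holds vacuously (no piece
  qualifies: `b ≥ y^{2+κ} ≥ y^A ≥ 2ⁿ` contradicts `b(1+θ) ≤ 2ⁿ`, `θ > 0`); the content of the
  hypothesis sits at `A > 2 + κ`.
-/

set_option linter.dupNamespace false -- D-0017: single-problem summit ⇒ `QuantumAdvantage.QuantumAdvantage` by design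

noncomputable section

namespace Summit.QuantumAdvantage.QuantumAdvantage.Theorems.LiouvilleOrthogonalTC0

open Filter Finset
open Literature.Computability.Complexity

namespace HypZero

/-- Every element of the degenerate piece `U(n; 1, 1; 1, 1)` equals `1`. -/
theorem eq_one_of_mem_pieceSet {n u : ℕ} (hu : u ∈ pieceSet n 1 1 1 1) : u = 1 := by
  simp only [pieceSet, Finset.mem_filter, Finset.mem_range] at hu
  obtain ⟨-, -, h1, h2⟩ := hu
  have h1' : 1 ≤ u := by exact_mod_cast h1
  have h2' : (u : ℝ) < 2 := by linarith
  have h2'' : u < 2 := by exact_mod_cast h2'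
  omega

/-- `1` lies in the degenerate piece `U(n; 1, 1; 1, 1)` as soon as `n ≥ 1`. -/
theorem one_mem_pieceSet {n : ℕ} (hn : 1 ≤ n) : 1 ∈ pieceSet n 1 1 1 1 := by
  simp only [pieceSet, Finset.mem_filter, Finset.mem_range]
  refine ⟨?_, ⟨one_ne_zero, ?_⟩, by norm_num, by norm_num⟩
  · calc 1 < 2 ^ 1 := by norm_num
      _ ≤ 2 ^ n := Nat.pow_le_pow_right (by norm_num) hn
  · intro p hp
    simp at hp

/-- `[λ(1) = -1]` is `false`. -/
theorem lamBit_one : lamBit 1 = false := by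
  simp [lamBit, ArithmeticFunction.liouville_apply_one]

end HypZero

/-- **The hypothesis is false at the degenerate scale exponent `A = 0`** (for every `δ₀ > 0`):
with `n / 0 = 0` and `n ^ (-0) = 1` the piece `U(n; 1, 1; 1, 1) = {1}` qualifies and the constant
circuit `false` (depth `1`, one gate) makes no error on it. -/
theorem not_localPieceHardness_zero (δ₀ κ Λ₀ : ℝ) (hδ₀ : 0 < δ₀) :
    ¬ LocalPieceHardness δ₀ κ Λ₀ 0 := by
  intro h
  have h1 := h 1 1
  obtain ⟨n, hn, hn1⟩ := (h1.and (eventually_ge_atTop 1)).exists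
  have hg : (fun _ : Fin n → Bool => false) ∈ TCFun n 1 ((1 : Polynomial ℕ).eval n) := by
    show ACRealOver tcBasis (fun _ : Fin n → Bool => false) 1 (Polynomial.eval n 1)
    rw [Polynomial.eval_one]
    exact acRealOver_const acBasis_subset_tcBasis false
  have hcard1 : (1 : ℝ) ≤ #(pieceSet n 1 1 1 1) := by
    exact_mod_cast Finset.one_le_card.mpr ⟨1, HypZero.one_mem_pieceSet hn1⟩
  have hy : (2 : ℝ) ^ ((n : ℝ) / ((0 : ℕ) : ℝ)) ≤ ((1 : ℕ) : ℝ) := by simp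
  have hz : (((1 : ℕ) : ℝ)) ^ Λ₀ ≤ ((1 : ℕ) : ℝ) := by simp
  have hb : (((1 : ℕ) : ℝ)) ^ (2 + κ) ≤ (1 : ℝ) := by simp
  have hθ : ((n : ℕ) : ℝ) ^ (-((0 : ℕ) : ℝ)) ≤ (1 : ℝ) := by simp
  have hbox : (1 : ℝ) * (1 + 1) ≤ (2 : ℝ) ^ n := by
    have : (2 : ℝ) ≤ 2 ^ n := by
      calc (2 : ℝ) = 2 ^ 1 := by norm_num
        _ ≤ 2 ^ n := pow_le_pow_right₀ (by norm_num) hn1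
    linarith
  have hU : (2 : ℝ) ^ ((n : ℝ) / ((0 : ℕ) : ℝ)) ≤ #(pieceSet n 1 1 1 1) := by
    simpa using hcard1
  have key := hn 1 1 1 1 hy hz hb hθ le_rfl hbox hU _ hg
  have hempty : ((pieceSet n 1 1 1 1).filter
      fun u => (fun _ : Fin n → Bool => false) (bits n u) ≠ lamBit u) = ∅ := by
    refine Finset.filter_eq_empty_iff.mpr ?_
    intro u hu
    rw [HypZero.eq_one_of_mem_pieceSet hu, HypZero.lamBit_one]
    simp
  rw [hempty, Finset.card_empty, Nat.cast_zero] at key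
  nlinarith

/-- **The unrestricted stub is refuted**: no `(δ₀, κ, Λ₀)` with `δ₀ > 0` gives
`LocalPieceHardness δ₀ κ Λ₀ A` for ALL `A : ℕ`, because `A = 0` fails. (This is why the line's open
stub is stated for `A ≥ 1`.) -/
theorem not_exists_localPieceHardness_all :
    ¬ ∃ δ₀ κ Λ₀ : ℝ, 0 < δ₀ ∧ 0 < κ ∧ 1 ≤ Λ₀ ∧ ∀ A : ℕ, LocalPieceHardness δ₀ κ Λ₀ A := by
  rintro ⟨δ₀, κ, Λ₀, hδ₀, -, -, h⟩
  exact not_localPieceHardness_zero δ₀ κ Λ₀ hδ₀ (h 0)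

/-- **Antitonicity in the scale exponent**: for `1 ≤ A ≤ A'`, hardness at `A'` implies hardness at
`A` (a piece qualifying for `A` qualifies for `A'`: `2^{n/A} ≥ 2^{n/A'}` and `n^{-A} ≥ n^{-A'}`). -/
theorem localPieceHardness_anti {δ₀ κ Λ₀ : ℝ} {A A' : ℕ} (hA : 1 ≤ A) (hAA' : A ≤ A')
    (h : LocalPieceHardness δ₀ κ Λ₀ A') : LocalPieceHardness δ₀ κ Λ₀ A := by
  intro d p
  filter_upwards [h d p, eventually_ge_atTop 1] with n hn hn1
  intro y z b θ hy hz hb hθ hθ1 hbox hU g hg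
  have hAr : (0 : ℝ) < A := by exact_mod_cast hA
  have hA'r : (A : ℝ) ≤ A' := by exact_mod_cast hAA'
  have hdiv : (n : ℝ) / A' ≤ (n : ℝ) / A := div_le_div_of_nonneg_left (Nat.cast_nonneg n) hAr hA'r
  have hpow : (2 : ℝ) ^ ((n : ℝ) / A') ≤ (2 : ℝ) ^ ((n : ℝ) / A) :=
    Real.rpow_le_rpow_of_exponent_le (by norm_num) hdiv
  have hn1r : (1 : ℝ) ≤ n := by exact_mod_cast hn1
  have hneg : (n : ℝ) ^ (-(A' : ℝ)) ≤ (n : ℝ) ^ (-(A : ℝ)) :=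
    Real.rpow_le_rpow_of_exponent_le hn1r (by linarith)
  exact hn y z b θ (hpow.trans hy) hz hb (hneg.trans hθ) hθ1 hbox (hpow.trans hU) g hg

/-- **Vacuous range**: for `1 ≤ A ≤ 2 + κ` no piece qualifies (`b ≥ y^{2+κ} ≥ y^A ≥ 2ⁿ` contradicts
`b(1+θ) ≤ 2ⁿ` with `θ ≥ n^{-A} > 0`), so the hypothesis holds trivially there; its content sits at
`A > 2 + κ`. -/
theorem localPieceHardness_of_le (δ₀ κ Λ₀ : ℝ) {A : ℕ} (hA : 1 ≤ A) (hAκ : (A : ℝ) ≤ 2 + κ) :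
    LocalPieceHardness δ₀ κ Λ₀ A := by
  intro d p
  filter_upwards [eventually_ge_atTop 1] with n hn1
  intro y z b θ hy hz hb hθ hθ1 hbox hU g hg
  exfalso
  have hAr : (0 : ℝ) < A := by exact_mod_cast hA
  have hn1r : (1 : ℝ) ≤ n := by exact_mod_cast hn1
  have hy1 : (1 : ℝ) ≤ y := le_trans (Real.one_le_rpow (by norm_num) (by positivity)) hy
  have hyA : (2 : ℝ) ^ (n : ℝ) ≤ (y : ℝ) ^ (A : ℝ) := by
    have h1 := Real.rpow_le_rpow (by positivity) hy (Nat.cast_nonneg A)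
    rw [← Real.rpow_mul (by norm_num), div_mul_cancel₀ _ (ne_of_gt hAr)] at h1
    exact h1
  have hyk : (y : ℝ) ^ (A : ℝ) ≤ (y : ℝ) ^ (2 + κ) := Real.rpow_le_rpow_of_exponent_le hy1 hAκ
  have h2n : (2 : ℝ) ^ n ≤ b := by
    have : (2 : ℝ) ^ (n : ℝ) = 2 ^ n := Real.rpow_natCast 2 n
    linarith [hyA, hyk, hb]
  have hθpos : 0 < θ := lt_of_lt_of_le (Real.rpow_pos_of_pos (by linarith) _) hθ
  have h2pos : (0 : ℝ) < 2 ^ n := by positivity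
  have : (2 : ℝ) ^ n < b * (1 + θ) := by nlinarith
  linarith

end Summit.QuantumAdvantage.QuantumAdvantage.Theorems.LiouvilleOrthogonalTC0
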